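import Literature.MathematicalPhysics.QuantumFieldTheory.Balaban1983to89.B8CubeMemberTorusClasses
import Literature.MathematicalPhysics.QuantumFieldTheory.Balaban1983to89.B8Eq138LandauFlatOrthogonal

/-!
# `Balaban1983to89.B8CubeMemberTorusLandau` — TRANSPLANT STEP T3b of the N05 flat road: THE LANDAU CONDITION TRANSFERS —
# [Balaban1985RegularSpaces] (1.38) «R(U₀)D^{η*}_{U₀}A = 0» at `U₀ = 1` in multiplier form on the cube member (`B8Eq138LandauZd.IsLandau138`) implies
# [Balaban1984PropagatorsII] (2.12) «R∂*A = 0» (`B6SectAOperatorsV1.RE (domT hN D hk) c (dsE c A) = 0`) for the member's field transplanted to the V1 torus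

statement-level skeleton of published theorems with citation tags; proofs where landed; nothing here is a claim about the
Yang–Mills mass gap

`[Balaban1985RegularSpaces]` (1.38) p. 82, (1.29) p. 81; `[Balaban1984PropagatorsII]` (2.7) p. 224 («λ = 0 on Λ₀, Q′_jλ = 0 on Λ_j»), (2.10)–(2.12) p. 225 («R the orthogonal
projection onto ΔN(Q′) … R∂*A = 0»); `[Balaban1985BackgroundPropagators]` (3.19)–(3.25) pp. 393–394.  PDF held: `paper:balaban1985-cmp99-regular-spaces-gauge-fixing`.

CITATION HEADER (lean-in-tree rule).  Cell `pub-ymgap` (YM Track A, HUMAN RULING D-0062), DAG node N05 = [B8], seat `pub-ymgap-dag-n05-c` (g12), `TRANSPLANT-DESIGN.md` step T3b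
(dictionary item (D3); ref-E g13 READ-6 caveat (D3′): real inner product on the finite torus vs bilinear `finsum` pairing on `ℤᵈ`).  WHY THIS FILE.  The torus reading of (1.59)
takes the Landau condition as `RE (domT hN D hk) c (dsE c A) = 0`; p21's `RE_eq_zero_iff` reads it as «`⟪Δn, ∂*A⟫_ℝ = 0` for every `n ∈ N(Q′)`»; the member carries (1.38) in the
multiplier form `IsLandau138` on `Ω₀ = □₀` with `Λ′`-tower `cubeLamS … m`, and this seat's `B8Eq138LandauFlatOrthogonal.pairing_covLap_eq_zero_of_isLandau138` (p580574) turns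
the multiplier form into the pairing form «`Σ_x (Δ^η_1λ)(x)·(𝟙_{□₀}D^{η*}_1φ)(x) = 0` for `λ ∈ N(Q′)` supported in `□₀`».  THIS FILE closes the triangle: a torus gauge function
`n ∈ ker Q′` of `domT hN D hk` at `D = cubeTDomainsL0 …` vanishes off `t + □₁` (level 0: `Q′₀ = id`) and has zero block sums on the member's `Λ_j` (levels `1 … m`, the class
dictionary of `B8CubeMemberTorusClasses`); pulled back along the chart and the shift it is such a `λ` (real-valued); the torus pairing is the `ℤ^{d+1}` pairing read through
`laplace_liftS`∕`diverg_liftB` of `B8CubeMemberTorusChart`, and the real functional `g` (`re`∕`im`) comes out because `Δλ` is real.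

HONEST SCOPE ∕ NOT CLAIMED.  Bookkeeping over landed identities; no estimate.  Count-neutral; N05 NOT discharged; one finite `T⁴` programme at fixed `ε`, Bałaban as printed; nothing
continuum ∕ ℝ⁴ ∕ OS ∕ mass-gap ∕ Clay.  No `sorry`, no `def`, no `instance`, no `notation`.  Unit `pub-ymgap-dag-n05-c` (g12), 2026-08-28.
-/
noncomputable section

namespace Literature.MathematicalPhysics.QuantumFieldTheory.Balaban1983to89.B8CubeMemberTorusLandau

open B4Reflection242 (boxDom mem_boxDom)
open B6MultiLevelBoxOperator (N0)
open B6GlobalChartV1 (PV toBox toBox_apply boxEquiv boxEquiv_apply)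
open B6GlobalChartV1L0 (domT)
open B6SectAOperatorsV1 (dsE dE lapE QpE RE RE_eq_zero_iff mem_ker_QpE_iff lapE_apply dsE_apply inner_eq_sum ScalarSpace)
open BalabanImbrieJaffe1984to88.BIJ85AxialPropagator411 (BondSpace)
open B7Prop1Explicit (e e_apply)
open B7Prop1Local (InBox)
open B8Eq131Cubes (cube sqLo sqHi inLo inHi)
open B8Eq131CubesAdmissible (cubeFam cubeFam_false_of_le cubeFam_false_zero)
open B8Eq191FlatLettersCubeMember (inBox_finite)
open B8CubeMemberZd (cubeLamS cubeLam cubeLamS_of_lt cubeLamS_self mem_cubeLam_zero_iff)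
open B8CubeMemberBoxDomains (shift boxP)
open B8CubeMemberTorusDomainsL0 (cubeTDomainsL0 siteDeep_shift_of_mem_cube_zero)
open B8CubeMemberTorusChart (toTorus labels labels_eq_toBox toTorus_labels labels_toTorus labels_nonneg labels_lt DeepSupp liftB liftS liftB_apply liftS_apply
  laplace_liftS diverg_liftB)
open B8CubeMemberTorusAverages (labelsJ labelsJ_zero exists_iterBlockOf_eq labels_toTorus_corner toTorus_corner_mem_iterBlock sum_iterBlock_eq_sum_boxVec)
open B8CubeMemberTorusClasses (labelsJ_iterBlockOf shiftJ shift_eq_smul_shiftJ blockMap_sub_smul mem_cube_iff_blockMap mem_Om_iff deep_iff_of_lt not_deep_top deep_zero_iff)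
open B8Eq138LandauZd (IsLandau138 covLap covDivB)
open B8Eq191FlatStencils (covLap_flat_apply)
open B8Eq138LandauFlatOrthogonal (pairing_covLap_eq_zero_of_isLandau138)
open B5Eq118OneStroke (iterBlockOf iterBlock mem_iterBlock siteAvgIter_eq_blockSum)
open LatticeFieldCalculus (laplace diverg siteAvgIter)
open Literature.MathematicalPhysics.QuantumLattice (blockMap blockSites mem_blockSites_iff)

variable {d ℓ mV KV : ℕ} {hd : 1 ≤ d + 1} {hL : Odd (ℓ + 1) ∧ 1 < ℓ + 1}

/-! ## §1 Sums over the torus are sums over the fundamental box of labels; translation of `finsum` -/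

/-- **A SUM OVER THE SITES OF THE TORUS IS A SUM OVER THE FUNDAMENTAL BOX OF LABELS** (the label chart is a bijection, `B6GlobalChartV1.boxEquiv`).
[cite: Balaban1984PropagatorsII, (2.1) p.224; Balaban1983RegularityDecay, p.572, dictionary] -/
theorem sum_univ_labels {M : Type*} [AddCommMonoid M] {Mh k : ℕ} {P' : Fin (d + 1) → ℕ} (hN : ∀ μ, N0 ℓ Mh k P' μ = (PV d ℓ mV KV hd hL).sitesPerDir 0)
    (F : (Fin (d + 1) → ℤ) → M) : ∑ y : Site (PV d ℓ mV KV hd hL) 0, F (labels y) = ∑ w ∈ boxDom (N0 ℓ Mh k P'), F w := by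
  rw [← Finset.sum_coe_sort (boxDom (N0 ℓ Mh k P')), ← Equiv.sum_comp (boxEquiv hN) (fun z => F z.1)]
  rfl

/-- a sum over the box of a function supported in the box is its `finsum`. [folklore] [cite: Balaban1984PropagatorsII, (2.10) p.225, dictionary] -/
theorem sum_boxDom_eq_finsum {M : Type*} [AddCommMonoid M] (N : Fin (d + 1) → ℕ) {F : (Fin (d + 1) → ℤ) → M} (hF : ∀ w, w ∉ boxDom N → F w = 0) :
    ∑ w ∈ boxDom N, F w = ∑ᶠ w, F w := by
  symm
  exact finsum_eq_sum_of_support_subset _ fun w hw => by by_contra h; exact hw (hF w h)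

/-- translation invariance of `finsum` on `ℤ^{d+1}`: `Σ_w F(w − t) = Σ_z F(z)`. [folklore] [cite: Balaban1984PropagatorsII, (2.10) p.225, dictionary] -/
theorem finsum_sub_translate {M : Type*} [AddCommMonoid M] (t : Fin (d + 1) → ℤ) (F : (Fin (d + 1) → ℤ) → M) : ∑ᶠ w, F (w - t) = ∑ᶠ z, F z :=
  finsum_comp_equiv (Equiv.subRight t) (f := F)

/-! ## §2 A torus gauge function pulled back to `ℤ^{d+1}` is in the member's `N(Q′)` -/

section Member

variable {Mh : ℕ} (hℓ : 1 ≤ ℓ) (hMh : 2 ≤ Mh) (a : Fin (d + 1) → ℤ) {M ρ k n R : ℕ} (hn : 1 ≤ n) (hnk : n ≤ k)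
  (hρ : Mh * (ℓ + 1) ∣ ρ) (hM : Mh * (ℓ + 1) ∣ M) (hρ0 : 0 < ρ) (hR : R * (Mh * (ℓ + 1)) ≤ ρ)
  {P : Fin (d + 1) → ℕ} (hfit : ∀ μ, boxP ℓ M ρ k n μ ≤ P μ) (hN : ∀ μ, N0 ℓ Mh n P μ = (PV d ℓ mV KV hd hL).sitesPerDir 0) (hk : n ≤ mV + KV)

/-- **A GAUGE FUNCTION OF THE TORUS READING VANISHES OFF `t + □₁`** («λ = 0 on Λ₀», `Q′₀ = id`, `Λ₀ = T ∖ (t + □₁)`).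
[cite: Balaban1984PropagatorsII, (2.7) p.224 («λ = 0 on Λ₀»), (2.14) p.225 («(Q′₀λ)(x) = λ(x), x ∈ Λ₀»); Balaban1985RegularSpaces, (1.131) p.99] -/
theorem eq_zero_of_inGauge_of_not_mem {nf : Site (PV d ℓ mV KV hd hL) 0 → ℝ} (hn' : (domT hN (cubeTDomainsL0 hℓ hMh a hn hnk hρ hM hρ0 hR P hfit) hk).InGauge nf)
    {y : Site (PV d ℓ mV KV hd hL) 0} (hy : labels y - shift ℓ Mh a ρ k n ∉ cube (ℓ + 1) a M ρ k 1) : nf y = 0 := by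
  have h := hn' 0 y ⟨by rw [(domT hN _ hk).Om_zero]; exact Finset.mem_univ _, by
    rw [deep_zero_iff hℓ hMh a hn hnk hρ hM hρ0 hR hfit hN hk]; exact hy⟩
  simpa [siteAvgIter] using h

/-- **THE BLOCK SUMS OF A GAUGE FUNCTION VANISH ON THE MEMBER's `Λ_j`** (`1 ≤ j ≤ n`): for `y ∈ cubeLamS … n j` (coarse, untranslated) the sum of `nf ∘ toTorus` over the
`Lʲ`-block of `y + t_j` is zero («Q′_jλ = 0 on Λ_j»). [cite: Balaban1984PropagatorsII, (2.7) p.224 («Q′_jλ = 0 on Λ_j, j = 1, …, k»), (1.20) p.20 of [B5]; Balaban1985RegularSpaces, (1.29) p.81, (1.131) p.99] -/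
theorem blockSum_eq_zero_of_inGauge {nf : Site (PV d ℓ mV KV hd hL) 0 → ℝ} (hn' : (domT hN (cubeTDomainsL0 hℓ hMh a hn hnk hρ hM hρ0 hR P hfit) hk).InGauge nf)
    {j : ℕ} (hj1 : 1 ≤ j) (hjn : j ≤ n) {y : Fin (d + 1) → ℤ} (hy : y ∈ cubeLamS (ℓ + 1) a M ρ k n j) :
    ∑ w ∈ blockSites ((ℓ + 1) ^ j) (y + shiftJ ℓ Mh a ρ k n j), nf (toTorus (hd := hd) (hL := hL) (mV := mV) (KV := KV) (ℓ := ℓ) w) = 0 := by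
  classical
  have hj : j ≤ mV + KV := hjn.trans hk
  have hLj : 0 < (ℓ + 1) ^ j := pow_pos (Nat.succ_pos ℓ) j
  haveI : NeZero ((ℓ + 1) ^ j) := ⟨hLj.ne'⟩
  -- `y` read in print's sets
  have hsq : InBox (sqLo (ℓ + 1) a ρ k j) (sqHi (ℓ + 1) a M ρ k j) y ∧ (j < n → ¬ InBox (inLo (ℓ + 1) a ρ k j) (inHi (ℓ + 1) a M ρ k j) y) := by
    rcases Nat.lt_or_ge j n with hlt | hge
    · rw [cubeLamS_of_lt (ℓ + 1) a M ρ k hlt] at hy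
      exact ⟨hy.1, fun _ => hy.2 (lt_of_lt_of_le hlt hnk)⟩
    · have hjn' : j = n := le_antisymm hjn hge
      subst hjn'
      rw [cubeLamS_self] at hy
      exact ⟨hy, fun h => absurd h (lt_irrefl _)⟩
  -- the coarse torus site over `y + t_j`: its labels are `y + t_j` (deep enough to be in range)
  set c : Fin (d + 1) → ℤ := y + shiftJ ℓ Mh a ρ k n j with hc
  -- a fine corner in the box: `Lʲ·c` is the translate of `Lʲ·y ∈ □_j ⊂ □₀`
  have hcorner : (((ℓ + 1) ^ j : ℕ) : ℤ) • c - shift ℓ Mh a ρ k n ∈ cube (ℓ + 1) a M ρ k j := by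
    rw [shift_eq_smul_shiftJ ℓ Mh a hjn hnk, hc, smul_add, add_sub_cancel_right, Nat.cast_pow]
    exact (B8Eq131CubesAdmissible.smul_mem_cube_iff (Nat.succ_pos ℓ) a M ρ k j y).2 hsq.1
  have hcorner0 : (((ℓ + 1) ^ j : ℕ) : ℤ) • c - shift ℓ Mh a ρ k n ∈ cube (ℓ + 1) a M ρ k 0 :=
    B8Eq131Cubes.cube_anti (Nat.zero_le j) (hjn.trans hnk) hcorner
  have hdeep := siteDeep_shift_of_mem_cube_zero hℓ hMh a hn hnk hfit hcorner0
  rw [sub_add_cancel] at hdeep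
  have hinbox : ∀ μ, 0 ≤ ((((ℓ + 1) ^ j : ℕ) : ℤ) • c) μ ∧ ((((ℓ + 1) ^ j : ℕ) : ℤ) • c) μ < ((PV d ℓ mV KV hd hL).sitesPerDir 0 : ℕ) := by
    intro μ
    obtain ⟨h1, h2⟩ := hdeep μ
    rw [hN μ] at h2
    have h0 : (0 : ℤ) < ((ρ * (ℓ + 1) ^ n : ℕ) : ℤ) := by exact_mod_cast Nat.mul_pos hρ0 (pow_pos (Nat.succ_pos ℓ) n)
    exact ⟨le_trans h0.le h1, by linarith⟩
  set x₀ : Site (PV d ℓ mV KV hd hL) 0 := toTorus ((((ℓ + 1) ^ j : ℕ) : ℤ) • c) with hx₀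
  have hlab : labels x₀ = (((ℓ + 1) ^ j : ℕ) : ℤ) • c := labels_toTorus hinbox
  have hcoarse : labelsJ (iterBlockOf j x₀) = c := by
    rw [labelsJ_iterBlockOf hj, hlab]
    have := blockMap_sub_smul (d := d) hLj 0 c
    simp only [zero_sub] at this
    funext μ
    simp only [blockMap, Pi.smul_apply, smul_eq_mul]
    rw [mul_comm, Int.mul_ediv_cancel _ (by exact_mod_cast hLj.ne')]
  -- `LamSite j (iterBlockOf j x₀)`
  have hLam : (domT hN (cubeTDomainsL0 hℓ hMh a hn hnk hρ hM hρ0 hR P hfit) hk).LamSite j (iterBlockOf j x₀) := by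
    refine ⟨(mem_Om_iff hℓ hMh a hn hnk hρ hM hρ0 hR hfit hN hk hj1 hjn _).2 (by rw [hcoarse, hc, add_sub_cancel_right]; exact hsq.1), ?_⟩
    rcases Nat.lt_or_ge j n with hlt | hge
    · rw [deep_iff_of_lt hℓ hMh a hn hnk hρ hM hρ0 hR hfit hN hk hlt, hcoarse, hc, add_sub_cancel_right]
      exact hsq.2 hlt
    · have hjn' : j = n := le_antisymm hjn hge
      subst hjn'
      exact not_deep_top hℓ hMh a hn hnk hρ hM hρ0 hR hfit hN hk _
  -- the block average vanishes, hence the block sum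
  have havg := hn' j (iterBlockOf j x₀) hLam
  rw [siteAvgIter_eq_blockSum j hj] at havg
  have hLd : ((((ℓ + 1 : ℕ) : ℝ) ^ (d + 1)) ^ j)⁻¹ ≠ 0 := by positivity
  have hsum : ∑ x ∈ iterBlock j (iterBlockOf j x₀), nf x = 0 := by
    have h' : ((((PV d ℓ mV KV hd hL).L : ℝ) ^ (PV d ℓ mV KV hd hL).d) ^ j)⁻¹ • ∑ x ∈ iterBlock j (iterBlockOf j x₀), nf x = 0 := havg
    rw [smul_eq_zero] at h'
    rcases h' with h' | h'
    · exact absurd h' hLd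
    · exact h'
  -- read the block through the labels
  have hread : ∑ x ∈ iterBlock j (iterBlockOf j x₀), nf x =
      ∑ x ∈ iterBlock j (iterBlockOf j x₀), (fun w => nf (toTorus (hd := hd) (hL := hL) (mV := mV) (KV := KV) (ℓ := ℓ) w)) (labels x) := by
    refine Finset.sum_congr rfl fun x _ => ?_
    simp only [toTorus_labels]
  rw [hread, sum_iterBlock_eq_sum_boxVec hj (iterBlockOf j x₀) (fun w => nf (toTorus (hd := hd) (hL := hL) (mV := mV) (KV := KV) (ℓ := ℓ) w))] at hsum
  rw [hcoarse] at hsum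
  -- the integer box `Lʲ·c + [0, Lʲ)^{d+1}` is `blockSites (Lʲ) c`
  rw [← hsum]
  symm
  refine Finset.sum_nbij (fun r => (((ℓ + 1) ^ j : ℕ) : ℤ) • c + B7Prop1Explicit.boxVec ((ℓ + 1) ^ j) r) (fun r _ => ?_) (fun r _ r' _ h => ?_) (fun w hw => ?_)
    (fun _ _ => rfl)
  · rw [mem_blockSites_iff]
    funext μ
    simp only [blockMap, Pi.add_apply, Pi.smul_apply, smul_eq_mul, B7Prop1Explicit.boxVec]
    have h2 : ((r μ : ℕ) : ℤ) < (((ℓ + 1) ^ j : ℕ) : ℤ) := by exact_mod_cast (r μ).isLt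
    have h0 : (0 : ℤ) ≤ ((r μ : ℕ) : ℤ) := by positivity
    rw [show (((ℓ + 1) ^ j : ℕ) : ℤ) * c μ + ((r μ : ℕ) : ℤ) = ((r μ : ℕ) : ℤ) + c μ * (((ℓ + 1) ^ j : ℕ) : ℤ) by ring,
      Int.add_mul_ediv_right _ _ (by exact_mod_cast hLj.ne'), Int.ediv_eq_zero_of_lt h0 h2, zero_add]
  · have h' : ∀ μ, ((r μ : ℕ) : ℤ) = ((r' μ : ℕ) : ℤ) := fun μ => by
      have := congrFun h μ; simpa [B7Prop1Explicit.boxVec] using this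
    funext μ; exact Fin.ext (by exact_mod_cast h' μ)
  · rw [Finset.mem_coe, mem_blockSites_iff] at hw
    refine ⟨fun μ => ⟨(w μ - (((ℓ + 1) ^ j : ℕ) : ℤ) * c μ).toNat, ?_⟩, Finset.mem_coe.2 (Finset.mem_univ _), ?_⟩
    · have hμ := congrFun hw μ
      simp only [blockMap] at hμ
      have h1 := Int.ediv_mul_le (w μ) (by exact_mod_cast hLj.ne' : (((ℓ + 1) ^ j : ℕ) : ℤ) ≠ 0)
      have h2 := Int.lt_ediv_add_one_mul_self (w μ) (by exact_mod_cast hLj : (0 : ℤ) < (((ℓ + 1) ^ j : ℕ) : ℤ))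
      rw [hμ] at h1 h2
      have : w μ - (((ℓ + 1) ^ j : ℕ) : ℤ) * c μ < (((ℓ + 1) ^ j : ℕ) : ℤ) := by linarith
      omega
    · funext μ
      have hμ := congrFun hw μ
      simp only [blockMap] at hμ
      have h1 := Int.ediv_mul_le (w μ) (by exact_mod_cast hLj.ne' : (((ℓ + 1) ^ j : ℕ) : ℤ) ≠ 0)
      rw [hμ] at h1
      simp only [Pi.add_apply, Pi.smul_apply, smul_eq_mul, B7Prop1Explicit.boxVec]
      rw [Int.toNat_of_nonneg (by linarith)]
      ring

end Member

/-! ## §3 The Landau condition transfers -/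

section Landau

variable {Mh : ℕ} (hℓ : 1 ≤ ℓ) (hMh : 2 ≤ Mh) (a : Fin (d + 1) → ℤ) {M ρ k n R : ℕ} (hn : 1 ≤ n) (hnk : n ≤ k)
  (hρ : Mh * (ℓ + 1) ∣ ρ) (hM : Mh * (ℓ + 1) ∣ M) (hρ0 : 0 < ρ) (hR : R * (Mh * (ℓ + 1)) ≤ ρ)
  {P : Fin (d + 1) → ℕ} (hfit : ∀ μ, boxP ℓ M ρ k n μ ≤ P μ) (hN : ∀ μ, N0 ℓ Mh n P μ = (PV d ℓ mV KV hd hL).sitesPerDir 0) (hk : n ≤ mV + KV)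

/-- ★★ **(1.38) AT THE MEMBER ⟹ (2.12) ON THE TORUS**: let `φ` be a `ℂ`-valued bond field of `ℤ^{d+1}` in the flat Landau gauge (1.38) of the cube member in multiplier form
(`IsLandau138 (ℓ+1) n η □₀ (cubeLamS … n) 1 φ`), and `ψ = φ(· − t)` its translate, supported `2`-deep in the fundamental box; then for every real functional `g` the transplanted
torus field `A = liftB g ψ` satisfies «`R∂*A = 0`» for the torus reading's projection `R = RE (domT hN D hk) η⁻¹`, `D = cubeTDomainsL0 …`.  Proof: `RE_eq_zero_iff` (p21) reduces to
`⟪Δn, ∂*A⟫ = 0` for gauge functions `n`; §2 makes the pull-back `λ(z) = n(toTorus (z + t))·𝟙_{□₀}(z)` an element of the member's `N(Q′)` (zero off `□₁`, zero block sums on `Λ_j`);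
`B8Eq138LandauFlatOrthogonal.pairing_covLap_eq_zero_of_isLandau138` (p580574) kills the `ℤ^{d+1}` pairing; the chart identities `laplace_liftS`∕`diverg_liftB` and the reality of `Δλ`
carry it to the torus inner product. [cite: Balaban1985RegularSpaces, (1.38) p.82, (1.29) p.81; Balaban1984PropagatorsII, (2.7) p.224, (2.10)–(2.12) p.225; Balaban1985BackgroundPropagators, (3.19) p.393, (3.24)–(3.25) p.394] -/
theorem RE_dsE_liftB_eq_zero {η : ℝ} {φ : (Fin (d + 1) → ℤ) → Fin (d + 1) → ℂ}
    (hLan : IsLandau138 (ℓ + 1) n η (cubeFam false (ℓ + 1) a M ρ k 0) (cubeLamS (ℓ + 1) a M ρ k n) (1 : (Fin (d + 1) → ℤ) → Fin (d + 1) → ℂˣ) φ)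
    (hψ : DeepSupp ((PV d ℓ mV KV hd hL).sitesPerDir 0) 2 (fun w => φ (w - shift ℓ Mh a ρ k n)))
    (h2N : (2 : ℤ) ≤ ((PV d ℓ mV KV hd hL).sitesPerDir 0 : ℕ)) (g : ℂ →ₗ[ℝ] ℝ) :
    RE (domT hN (cubeTDomainsL0 hℓ hMh a hn hnk hρ hM hρ0 hR P hfit) hk) η⁻¹
      (dsE η⁻¹ (WithLp.toLp 2 (liftB (hd := hd) (hL := hL) (mV := mV) (KV := KV) (ℓ := ℓ) g (fun w => φ (w - shift ℓ Mh a ρ k n))))) = 0 := by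
  classical
  set t := shift ℓ Mh a ρ k n with ht
  set ψ : (Fin (d + 1) → ℤ) → Fin (d + 1) → ℂ := fun w => φ (w - t) with hψdef
  have hL1 : 1 ≤ ℓ + 1 := Nat.succ_pos ℓ
  have hMh1 : 1 ≤ Mh := le_trans (by norm_num) hMh
  have hρL : ℓ + 1 ≤ ρ := le_trans (Nat.le_mul_of_pos_left _ hMh1) (Nat.le_of_dvd hρ0 hρ)
  rw [RE_eq_zero_iff]
  intro nvec hnvec
  rw [mem_ker_QpE_iff] at hnvec
  set nf : Site (PV d ℓ mV KV hd hL) 0 → ℝ := WithLp.ofLp nvec with hnf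
  -- the pull-back `fR(w) = n(toTorus w)·𝟙_{t + □₀}(w)` (translated coordinates), as a real and as a complex function
  set fR : (Fin (d + 1) → ℤ) → ℝ := fun w =>
    if w - t ∈ cube (ℓ + 1) a M ρ k 0 then nf (toTorus (hd := hd) (hL := hL) (mV := mV) (KV := KV) (ℓ := ℓ) w) else 0 with hfRdef
  set f : (Fin (d + 1) → ℤ) → ℂ := fun w => ((fR w : ℝ) : ℂ) with hfdef
  -- `fR` vanishes unless `w − t ∈ □₁`
  have hfR1 : ∀ w, w - t ∉ cube (ℓ + 1) a M ρ k 1 → fR w = 0 := by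
    intro w hw
    simp only [hfRdef]
    split_ifs with h0
    · have hbox : ∀ μ, 0 ≤ w μ ∧ w μ < ((PV d ℓ mV KV hd hL).sitesPerDir 0 : ℕ) := by
        intro μ
        have hdp := siteDeep_shift_of_mem_cube_zero hℓ hMh a hn hnk hfit h0 μ
        rw [sub_add_cancel, hN μ] at hdp
        have : (0 : ℤ) < ((ρ * (ℓ + 1) ^ n : ℕ) : ℤ) := by exact_mod_cast Nat.mul_pos hρ0 (pow_pos (Nat.succ_pos ℓ) n)
        exact ⟨by linarith [hdp.1], by linarith [hdp.2]⟩
      have hy : labels (toTorus (hd := hd) (hL := hL) (mV := mV) (KV := KV) (ℓ := ℓ) w) - t ∉ cube (ℓ + 1) a M ρ k 1 := by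
        rw [labels_toTorus hbox]; exact hw
      exact eq_zero_of_inGauge_of_not_mem hℓ hMh a hn hnk hρ hM hρ0 hR hfit hN hk hnvec hy
    · rfl
  have hf1 : ∀ w, w - t ∉ cube (ℓ + 1) a M ρ k 1 → f w = 0 := fun w hw => by
    simp only [hfdef, hfR1 w hw, Complex.ofReal_zero]
  -- `f` is supported deep (in `t + □₁ ⊂ t + □₀`, which is `ρLⁿ`-deep)
  have hfdeep : DeepSupp ((PV d ℓ mV KV hd hL).sitesPerDir 0) 2 f := by
    intro w hw μ
    have h1 : w - t ∈ cube (ℓ + 1) a M ρ k 1 := by by_contra h; exact hw (hf1 w h)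
    have h0 : w - t ∈ cube (ℓ + 1) a M ρ k 0 := B8Eq131Cubes.cube_anti (Nat.zero_le 1) (hn.trans hnk) h1
    have hdp := siteDeep_shift_of_mem_cube_zero hℓ hMh a hn hnk hfit h0 μ
    rw [sub_add_cancel, hN μ] at hdp
    have hρn : (4 : ℤ) ≤ ((ρ * (ℓ + 1) ^ n : ℕ) : ℤ) := by
      have h2n : 2 ≤ (ℓ + 1) ^ n := le_trans (by omega : 2 ≤ ℓ + 1) (Nat.le_self_pow (by omega) _)
      have : 2 * 2 ≤ ρ * (ℓ + 1) ^ n := Nat.mul_le_mul (by omega) h2n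
      exact_mod_cast this
    exact ⟨by linarith [hdp.1], by linarith [hdp.2]⟩
  -- `nf = liftS re f` on the torus
  have hnf_lift : WithLp.ofLp nvec = liftS (hd := hd) (hL := hL) (mV := mV) (KV := KV) (ℓ := ℓ) Complex.reLm f := by
    funext y
    rw [liftS_apply]
    simp only [Complex.reLm_coe, hfdef, Complex.ofReal_re, hfRdef]
    split_ifs with h0
    · rw [toTorus_labels]
    · have h1 : labels y - t ∉ cube (ℓ + 1) a M ρ k 1 := fun h => h0 (B8Eq131Cubes.cube_anti (Nat.zero_le 1) (hn.trans hnk) h)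
      exact eq_zero_of_inGauge_of_not_mem hℓ hMh a hn hnk hρ hM hρ0 hR hfit hN hk hnvec h1
  -- `Δ^η_1 f` is real: `Δf = ofReal ∘ R`
  set R : (Fin (d + 1) → ℤ) → ℝ := fun w => ∑ μ : Fin (d + 1), (η ^ 2)⁻¹ * (2 * fR w - fR (w + e μ) - fR (w - e μ)) with hRdef
  have hLapreal : ∀ w, covLap η (1 : (Fin (d + 1) → ℤ) → Fin (d + 1) → ℂˣ) f w = ((R w : ℝ) : ℂ) := by
    intro w
    rw [B8Ineq159FlatShellModeCrossingDatum.covLap_flat_mul]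
    simp only [hRdef, hfdef]
    push_cast
    rfl
  -- the torus inner product as a sum over labels
  rw [inner_eq_sum]
  have hterm : ∀ y : Site (PV d ℓ mV KV hd hL) 0,
      lapE η⁻¹ nvec y * dsE η⁻¹ (WithLp.toLp 2 (liftB (hd := hd) (hL := hL) (mV := mV) (KV := KV) (ℓ := ℓ) g ψ)) y =
        g (covLap η (1 : (Fin (d + 1) → ℤ) → Fin (d + 1) → ℂˣ) f (labels y) * covDivB η (1 : (Fin (d + 1) → ℤ) → Fin (d + 1) → ℂˣ) ψ (labels y)) := by
    intro y
    rw [lapE_apply, dsE_apply, WithLp.ofLp_toLp, hnf_lift, laplace_liftS (by norm_num) h2N Complex.reLm hfdeep, diverg_liftB (by norm_num) h2N g hψ,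
      hLapreal]
    simp only [Complex.reLm_coe, Complex.ofReal_re]
    rw [← Complex.real_smul, LinearMap.map_smul_of_tower, smul_eq_mul]
  simp only [hterm]
  rw [← map_sum, sum_univ_labels hN (fun w => covLap η (1 : (Fin (d + 1) → ℤ) → Fin (d + 1) → ℂˣ) f w * covDivB η 1 ψ w)]
  -- off the box both factors need not vanish, but `Δf` does: `f` is 2-deep
  have hoff : ∀ w, w ∉ boxDom (N0 ℓ Mh n P) → covLap η (1 : (Fin (d + 1) → ℤ) → Fin (d + 1) → ℂˣ) f w * covDivB η 1 ψ w = 0 := by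
    intro w hw
    have hz : ∀ v : Fin (d + 1) → ℤ, (∀ μ, |v μ| ≤ 1) → f (w + v) = 0 := by
      intro v hv
      by_contra hne
      apply hw
      rw [mem_boxDom]
      intro μ
      obtain ⟨h1, h2⟩ := hfdeep (w + v) hne μ
      have hvμ := abs_le.mp (hv μ)
      rw [hN μ]
      simp only [Pi.add_apply] at h1 h2
      exact ⟨by linarith, by linarith⟩
    rw [covLap_flat_apply]
    have h0 : f w = 0 := by have := hz 0 (fun μ => by simp); rwa [add_zero] at this
    have hp : ∀ μ, f (w + e μ) = 0 := fun μ => hz (e μ) (fun κ => by rw [e_apply]; split_ifs <;> simp)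
    have hm : ∀ μ, f (w - e μ) = 0 := fun μ => by
      rw [sub_eq_add_neg]; exact hz (-e μ) (fun κ => by rw [Pi.neg_apply, e_apply]; split_ifs <;> simp)
    simp [h0, hp, hm]
  rw [sum_boxDom_eq_finsum _ hoff]
  -- translate back to the member's coordinates: `w = z + t`
  have htrans : ∑ᶠ w, covLap η (1 : (Fin (d + 1) → ℤ) → Fin (d + 1) → ℂˣ) f w * covDivB η 1 ψ w =
      ∑ᶠ z, covLap η (1 : (Fin (d + 1) → ℤ) → Fin (d + 1) → ℂˣ) (fun z => f (z + t)) z * covDivB η 1 φ z := by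
    rw [← finsum_sub_translate (-t)]
    refine finsum_congr fun z => ?_
    simp only [sub_neg_eq_add]
    congr 1
    · rw [covLap_flat_apply, covLap_flat_apply]
      refine Finset.sum_congr rfl fun μ _ => ?_
      simp only [add_right_comm _ t]
      rw [show z + t - e μ = z - e μ + t by abel]
    · simp only [covDivB, B8Eq191FlatStencils.covDeriv_flat_apply, hψdef, add_sub_cancel_right]
      refine Finset.sum_congr rfl fun μ _ => ?_
      rw [show z + t - e μ - t = z - e μ by abel]
  rw [htrans]
  -- the pull-back `λ(z) = f(z + t)` is in the member's `N(Q′)`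
  set lam : (Fin (d + 1) → ℤ) → ℂ := fun z => f (z + t) with hlam
  have hsupp : ∀ z, z ∉ cubeFam false (ℓ + 1) a M ρ k 0 → lam z = 0 := by
    intro z hz
    rw [cubeFam_false_zero] at hz
    simp only [hlam, hfdef, hfRdef, add_sub_cancel_right, if_neg hz, Complex.ofReal_zero]
  have h0lev : ∀ z ∈ cubeLamS (ℓ + 1) a M ρ k n 0, lam z = 0 := by
    intro z hz
    rw [cubeLamS_of_lt (ℓ + 1) a M ρ k hn] at hz
    have hz1 := ((mem_cubeLam_zero_iff hL1 a M ρ (hn.trans hnk) z).1 hz).2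
    simp only [hlam]
    exact hf1 (z + t) (by rwa [add_sub_cancel_right])
  have hQ : ∀ j, 1 ≤ j → j ≤ n → ∀ y ∈ cubeLamS (ℓ + 1) a M ρ k n j, ∑ z ∈ blockSites ((ℓ + 1) ^ j) y, lam z = 0 := by
    intro j hj1 hjn y hy
    have hLj : 0 < (ℓ + 1) ^ j := pow_pos hL1 j
    haveI : NeZero ((ℓ + 1) ^ j) := ⟨hLj.ne'⟩
    have key := blockSum_eq_zero_of_inGauge hℓ hMh a hn hnk hρ hM hρ0 hR hfit hN hk hnvec hj1 hjn hy
    -- `blockSites (Lʲ) (y + t_j) = blockSites (Lʲ) y + t` and on it `f = n ∘ toTorus`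
    have hsq : InBox (sqLo (ℓ + 1) a ρ k j) (sqHi (ℓ + 1) a M ρ k j) y := by
      rcases Nat.lt_or_ge j n with hlt | hge
      · rw [cubeLamS_of_lt (ℓ + 1) a M ρ k hlt] at hy; exact hy.1
      · have hjn' : j = n := le_antisymm hjn hge
        subst hjn'; rw [cubeLamS_self] at hy; exact hy
    have hmemcube : ∀ z ∈ blockSites ((ℓ + 1) ^ j) y, z ∈ cube (ℓ + 1) a M ρ k 0 := by
      intro z hz
      rw [mem_blockSites_iff] at hz
      exact B8Eq131Cubes.cube_anti (Nat.zero_le j) (hjn.trans hnk) ((mem_cube_iff_blockMap hL1 z).2 (by rw [hz]; exact hsq))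
    have ht' : t = (((ℓ + 1) ^ j : ℕ) : ℤ) • shiftJ ℓ Mh a ρ k n j := shift_eq_smul_shiftJ ℓ Mh a hjn hnk
    -- reindex `z ↦ z + t` : `blockSites (Lʲ) y → blockSites (Lʲ) (y + t_j)`
    have hreidx : ∑ z ∈ blockSites ((ℓ + 1) ^ j) y, nf (toTorus (hd := hd) (hL := hL) (mV := mV) (KV := KV) (ℓ := ℓ) (z + t)) =
        ∑ w ∈ blockSites ((ℓ + 1) ^ j) (y + shiftJ ℓ Mh a ρ k n j), nf (toTorus (hd := hd) (hL := hL) (mV := mV) (KV := KV) (ℓ := ℓ) w) := by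
      refine Finset.sum_nbij (fun z => z + t) (fun z hz => ?_) (fun z _ z' _ h => by simpa using h) (fun w hw => ?_) (fun _ _ => rfl)
      · rw [mem_blockSites_iff] at hz ⊢
        rw [ht', show z + (((ℓ + 1) ^ j : ℕ) : ℤ) • shiftJ ℓ Mh a ρ k n j = z - (((ℓ + 1) ^ j : ℕ) : ℤ) • (-shiftJ ℓ Mh a ρ k n j) by
          rw [smul_neg, sub_neg_eq_add], blockMap_sub_smul hLj, hz, sub_neg_eq_add]
      · rw [Finset.mem_coe, mem_blockSites_iff] at hw
        refine ⟨w - t, ?_, by simp⟩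
        rw [Finset.mem_coe, mem_blockSites_iff, ht', blockMap_sub_smul hLj, hw, add_sub_cancel_right]
    have hlamval : ∀ z ∈ blockSites ((ℓ + 1) ^ j) y, lam z = ((nf (toTorus (hd := hd) (hL := hL) (mV := mV) (KV := KV) (ℓ := ℓ) (z + t)) : ℝ) : ℂ) := by
      intro z hz
      simp only [hlam, hfdef, hfRdef, add_sub_cancel_right, if_pos (hmemcube z hz)]
    rw [Finset.sum_congr rfl hlamval, ← Complex.ofReal_sum, hreidx, key, Complex.ofReal_zero]
  -- off `□₀` the pull-back and its neighbours vanish, so the pairing can be cut off by `𝟙_{□₀}`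
  have hΩfin : (cubeFam false (ℓ + 1) a M ρ k 0).Finite := by rw [cubeFam_false_zero]; exact inBox_finite _ _
  have hlam_near : ∀ z, z ∉ cube (ℓ + 1) a M ρ k 0 → ∀ v : Fin (d + 1) → ℤ, (∀ μ, |v μ| ≤ 1) → lam (z + v) = 0 := by
    intro z hz v hv
    simp only [hlam]
    refine hf1 _ ?_
    rw [add_sub_cancel_right]
    intro h1
    obtain ⟨i, hi⟩ := B8CubeMemberBoxDomains.collar_gap a (lt_of_lt_of_le Nat.zero_lt_one (hn.trans hnk)) hz h1
    have hvi := abs_le.mp (hv i)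
    simp only [Pi.add_apply, pow_zero, mul_one] at hi
    rw [show z i - (z i + v i) = -v i by ring, abs_neg] at hi
    have : (ρ : ℤ) < 1 := lt_of_lt_of_le hi (abs_le.mpr ⟨by linarith, by linarith⟩)
    have : (2 : ℤ) ≤ ρ := by exact_mod_cast (show 2 ≤ ρ by omega)
    linarith
  have hcut : ∑ᶠ z, covLap η (1 : (Fin (d + 1) → ℤ) → Fin (d + 1) → ℂˣ) lam z * covDivB η 1 φ z =
      ∑ᶠ z, covLap η (1 : (Fin (d + 1) → ℤ) → Fin (d + 1) → ℂˣ) lam z * (cubeFam false (ℓ + 1) a M ρ k 0).indicator (covDivB η 1 φ) z := by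
    refine finsum_congr fun z => ?_
    by_cases hz : z ∈ cubeFam false (ℓ + 1) a M ρ k 0
    · rw [Set.indicator_of_mem hz]
    · rw [Set.indicator_of_notMem hz, mul_zero]
      rw [cubeFam_false_zero] at hz
      have h0 : lam z = 0 := by have := hlam_near z hz 0 (fun μ => by simp); rwa [add_zero] at this
      have hp : ∀ μ, lam (z + e μ) = 0 := fun μ => hlam_near z hz (e μ) (fun κ => by rw [e_apply]; split_ifs <;> simp)
      have hm : ∀ μ, lam (z - e μ) = 0 := fun μ => by
        rw [sub_eq_add_neg]; exact hlam_near z hz (-e μ) (fun κ => by rw [Pi.neg_apply, e_apply]; split_ifs <;> simp)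
      rw [covLap_flat_apply]
      simp [h0, hp, hm]
  rw [hcut, pairing_covLap_eq_zero_of_isLandau138 hL1 hΩfin hLan hsupp h0lev hQ, map_zero]

end Landau

end Literature.MathematicalPhysics.QuantumFieldTheory.Balaban1983to89.B8CubeMemberTorusLandau
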